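import Summits.KontsevichZagierPeriods.KontsevichZagierPeriods.Theorems.GenusTwoCycleTransfer.Negative.Witnesses
import Literature.NumberTheory.Transcendental.KZSubcalculusInvariants
import Literature.NumberTheory.Transcendental.KZKernelConjectureForms

/-!
# `GenusTwoCycleTransfer` (stmt-KontsevichZagierPeriods-3408) — negative knowledge, part 2: forced moves, load-bearing hypotheses, sign pattern

Support file for the crux `HermiteRigidity.GenusTwoCycleTransfer` (cdisprove seat, cycle 1; work
file `Cruxes/GenusTwoCycleTransfer/Disproof.lean`), over the witnesses of part 1 (`Witnesses`).
For `f = x(x−1)(x−2)(x−3)(x−5)` and representations `r₁ r₂ r₃` on the ovals `(0,1), (2,3), (5,∞)`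
with integrand `1/√f` there:

* `genusTwoCycleTransfer_iff_exists` — the `∀ r₁ r₂ r₃` form of the crux is equivalent to ONE
  instance (representations with the same domain whose integrands agree on it are congruent modulo
  relations, `KZ.of_sub_of_mem_relations_of_eqOn`), and `hypotheses_satisfiable` — it is not vacuous;
* FORCED MOVES (refuted "sub-calculus" strengthenings): `not_mem_closure_cov_nl` — not derivable by
  rules (2)+(3) alone (coefficient sum `1`, `KZ.closure_cov_nl_le_ker_coeffSum`), and
  `not_mem_closure_add` — not derivable by the two additivity rules alone (restricted evaluation
  through the window `(5,∞)` is `I₃ > 0`, `KZ.closure_add_le_ker_restrictedEval`); the picked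
  derivation (three rule-2 push-forwards along a separating pencil + one rule-1b move) is
  consistent with both;
* LOAD-BEARING HYPOTHESES: each of the six hypotheses (three domain equations, three `EqOn`s) is
  necessary — the crux with that hypothesis deleted is FALSE (`genusTwoCycleTransfer_false_without_*`;
  two admissible witnesses of different value cannot both give relations, by soundness
  `KZ.relations_le_ker_eval_holds`);
* `all_plus_not_mem_relations` — the sign pattern `(+,+,+)` is never a relation (`I₁+I₂+I₃ > 0`);
* `genusTwoCycleTransfer_of_kontsevichZagierPeriods` — the summit together with the real-number
  identity `I₁ − I₂ + I₃ = 0` (Cauchy's theorem for `dz/√f` on the upper half-plane; certified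
  numerically on the item) implies the crux: a refutation of the crux would refute the summit's
  kernel form (`kzKernelConjecture_iff_isRational`, proved in tree).
[Kontsevich–Zagier 2001, §1.2] [folklore]
-/

noncomputable section

open Set MeasureTheory MvPolynomial
open Literature.NumberTheory.Transcendental Literature.ModelTheory.ExponentialFields
open Summit.KontsevichZagierPeriods.KontsevichZagierPeriods.Theses.HermiteRigidity (GenusTwoCycleTransfer)

namespace Summit.KontsevichZagierPeriods.HermiteRigidity.GenusTwoCycleTransferNegative

/-! ### §1 Unfolding and non-vacuity -/

/-- Soundness, unfolded: a relation has value `0` (`KZ.relations_le_ker_eval_holds`).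
[cite: KontsevichZagier2001, §1.2] -/
theorem eval_eq_zero_of_mem_relations {c : KZ.FormalRep} (h : c ∈ KZ.relations) : KZ.eval c = 0 :=
  (AddMonoidHom.mem_ker).1 (KZ.relations_le_ker_eval_holds h)

/-- **Non-vacuity.** The six hypotheses of `GenusTwoCycleTransfer` are simultaneously satisfiable.
[cite: KontsevichZagier2001, §1.1] -/
theorem hypotheses_satisfiable :
    ∃ r₁ r₂ r₃ : KZ.IntegralRep 1,
      r₁.domain = {p | 0 < p 0 ∧ p 0 < 1} ∧
      EqOn r₁.integrand (fun p => 1 / Real.sqrt (p 0 * (p 0 - 1) * (p 0 - 2) * (p 0 - 3) * (p 0 - 5))) {p | 0 < p 0 ∧ p 0 < 1} ∧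
      r₂.domain = {p | 2 < p 0 ∧ p 0 < 3} ∧
      EqOn r₂.integrand (fun p => 1 / Real.sqrt (p 0 * (p 0 - 1) * (p 0 - 2) * (p 0 - 3) * (p 0 - 5))) {p | 2 < p 0 ∧ p 0 < 3} ∧
      r₃.domain = {p | 5 < p 0} ∧ EqOn r₃.integrand (fun p => 1 / Real.sqrt (p 0 * (p 0 - 1) * (p 0 - 2) * (p 0 - 3) * (p 0 - 5))) {p | 5 < p 0} := by
  obtain ⟨r₁, hd₁, hi₁, -⟩ := exists_rep01
  obtain ⟨r₂, hd₂, hi₂, -⟩ := exists_rep23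
  obtain ⟨r₃, hd₃, hi₃, -⟩ := exists_rep5
  exact ⟨r₁, r₂, r₃, hd₁, fun p _ => congrFun hi₁ p, hd₂, fun p _ => congrFun hi₂ p, hd₃,
    fun p _ => congrFun hi₃ p⟩

/-- **The `∀`-form is one instance.** `GenusTwoCycleTransfer` holds iff SOME admissible triple gives
a relation: two representations with the same domain whose integrands agree on it are congruent
modulo `KZ.relations` (`KZ.of_sub_of_mem_relations_of_eqOn`), so the universal quantifier over
`r₁ r₂ r₃` hides no extra strength. [cite: KontsevichZagier2001, §1.2 rule (1)] -/
theorem genusTwoCycleTransfer_iff_exists :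
    GenusTwoCycleTransfer ↔ ∃ r₁ r₂ r₃ : KZ.IntegralRep 1,
      (r₁.domain = {p | 0 < p 0 ∧ p 0 < 1} ∧
        EqOn r₁.integrand (fun p => 1 / Real.sqrt (p 0 * (p 0 - 1) * (p 0 - 2) * (p 0 - 3) * (p 0 - 5))) {p | 0 < p 0 ∧ p 0 < 1} ∧
        r₂.domain = {p | 2 < p 0 ∧ p 0 < 3} ∧
        EqOn r₂.integrand (fun p => 1 / Real.sqrt (p 0 * (p 0 - 1) * (p 0 - 2) * (p 0 - 3) * (p 0 - 5))) {p | 2 < p 0 ∧ p 0 < 3} ∧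
        r₃.domain = {p | 5 < p 0} ∧
        EqOn r₃.integrand (fun p => 1 / Real.sqrt (p 0 * (p 0 - 1) * (p 0 - 2) * (p 0 - 3) * (p 0 - 5))) {p | 5 < p 0}) ∧
      KZ.of r₁ - KZ.of r₂ + KZ.of r₃ ∈ KZ.relations := by
  constructor
  · intro h
    obtain ⟨r₁, r₂, r₃, hd₁, hi₁, hd₂, hi₂, hd₃, hi₃⟩ := hypotheses_satisfiable
    exact ⟨r₁, r₂, r₃, ⟨hd₁, hi₁, hd₂, hi₂, hd₃, hi₃⟩, h r₁ r₂ r₃ hd₁ hi₁ hd₂ hi₂ hd₃ hi₃⟩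
  · rintro ⟨s₁, s₂, s₃, ⟨hs₁, hj₁, hs₂, hj₂, hs₃, hj₃⟩, h⟩ r₁ r₂ r₃ hd₁ hi₁ hd₂ hi₂ hd₃ hi₃
    have e₁ : KZ.of r₁ - KZ.of s₁ ∈ KZ.relations :=
      KZ.of_sub_of_mem_relations_of_eqOn (by rw [hd₁, hs₁])
        (by rw [hd₁]; exact fun p hp => (hi₁ hp).trans (hj₁ hp).symm)
    have e₂ : KZ.of r₂ - KZ.of s₂ ∈ KZ.relations :=
      KZ.of_sub_of_mem_relations_of_eqOn (by rw [hd₂, hs₂])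
        (by rw [hd₂]; exact fun p hp => (hi₂ hp).trans (hj₂ hp).symm)
    have e₃ : KZ.of r₃ - KZ.of s₃ ∈ KZ.relations :=
      KZ.of_sub_of_mem_relations_of_eqOn (by rw [hd₃, hs₃])
        (by rw [hd₃]; exact fun p hp => (hi₃ hp).trans (hj₃ hp).symm)
    have := KZ.relations.add_mem (KZ.relations.sub_mem (KZ.relations.add_mem h e₁) e₂) e₃
    convert this using 1
    abel

/-! ### §2 Which moves are forced: the relation lies in no obvious sub-calculus -/

/-- **Not derivable by change of variables + Newton–Leibniz alone** (rules (2)+(3)): the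
coefficient sum of `[r₁] − [r₂] + [r₃]` is `1`, while every move of type (2) or (3) is a difference
of two generators (`KZ.closure_cov_nl_le_ker_coeffSum`). So at least one additivity move is needed
(the pencil derivation uses exactly one `KZ.integrandAddRel` instance). Holds for ARBITRARY
`r₁ r₂ r₃`. [cite: KontsevichZagier2001, §1.2] -/
theorem not_mem_closure_cov_nl (r₁ r₂ r₃ : KZ.IntegralRep 1) :
    KZ.of r₁ - KZ.of r₂ + KZ.of r₃ ∉
      AddSubgroup.closure (KZ.changeOfVariablesRel ∪ KZ.newtonLeibnizRel) := by
  intro h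
  have := KZ.closure_cov_nl_le_ker_coeffSum h
  rw [AddMonoidHom.mem_ker] at this
  simp at this

/-- **Not derivable by the two additivity rules alone** (rules (1a)+(1b), the "scissors"
sub-calculus): restricted evaluation through the windows `(5,∞)ⁿ` (`KZ.restrictedEval`, an
invariant of the additivity moves, `KZ.closure_add_le_ker_restrictedEval`) sees only the third oval
and gives `I₃ > 0`. So a move of type (2) or (3) is needed (the pencil derivation uses three of
type (2)). [cite: KontsevichZagier2001, §1.2] -/
theorem not_mem_closure_add (r₁ r₂ r₃ : KZ.IntegralRep 1)
    (hd₁ : r₁.domain = {p | 0 < p 0 ∧ p 0 < 1}) (hd₂ : r₂.domain = {p | 2 < p 0 ∧ p 0 < 3})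
    (hd₃ : r₃.domain = {p | 5 < p 0})
    (hi₃ : EqOn r₃.integrand (fun p => 1 / Real.sqrt (p 0 * (p 0 - 1) * (p 0 - 2) * (p 0 - 3) * (p 0 - 5))) {p | 5 < p 0}) :
    KZ.of r₁ - KZ.of r₂ + KZ.of r₃ ∉ AddSubgroup.closure (KZ.domainAddRel ∪ KZ.integrandAddRel) := by
  intro h
  set A : (n : ℕ) → Set (Fin n → ℝ) := fun n => Set.pi univ fun _ => Ioi 5 with hA
  have hAm : ∀ n, MeasurableSet (A n) := fun n => MeasurableSet.univ_pi fun _ => measurableSet_Ioi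
  have hA1 : A 1 = {p | 5 < p 0} := by
    ext p
    simp [hA, Fin.forall_fin_one]
  have hk := KZ.closure_add_le_ker_restrictedEval A hAm h
  rw [AddMonoidHom.mem_ker, map_add, map_sub, KZ.restrictedEval_of, KZ.restrictedEval_of,
    KZ.restrictedEval_of, hA1, hd₁, hd₂, hd₃] at hk
  have e₁ : ({p : Fin 1 → ℝ | 0 < p 0 ∧ p 0 < 1} ∩ {p | 5 < p 0}) = ∅ := by
    ext p; simp only [mem_inter_iff, mem_setOf_eq, mem_empty_iff_false, iff_false]
    rintro ⟨⟨-, h1⟩, h5⟩; linarith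
  have e₂ : ({p : Fin 1 → ℝ | 2 < p 0 ∧ p 0 < 3} ∩ {p | 5 < p 0}) = ∅ := by
    ext p; simp only [mem_inter_iff, mem_setOf_eq, mem_empty_iff_false, iff_false]
    rintro ⟨⟨-, h1⟩, h5⟩; linarith
  rw [e₁, e₂, inter_self] at hk
  simp only [Measure.restrict_empty, integral_zero_measure, sub_zero, zero_add] at hk
  have hI : ∫ p in {p : Fin 1 → ℝ | 5 < p 0}, r₃.integrand p = r₃.value := by
    rw [KZ.IntegralRep.value, hd₃]
  rw [hI, value_eq_setIntegral (S := Ioi 5) hd₃ hi₃] at hk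
  exact (setIntegral_invSqrt_pos (by simp) (fun x hx => quintic_pos_5 hx) integrableOn_Ioi5).ne' hk

/-! ### §3 Load-bearing hypotheses: each of the six is necessary

Scheme: if hypothesis `H` on `rᵢ` is deleted, two admissible choices of `rᵢ` with DIFFERENT
values exist (the canonical witness of part 1 and the empty-domain / zero-integrand
representation); were both combinations relations, their difference `[rᵢ] − [rᵢ']` would be a
relation of non-zero value, contradicting soundness. Each `¬ (…)` below is the crux VERBATIM with
exactly one hypothesis removed. -/

/-- Two admissible third slots with different values cannot both give relations. [folklore] -/
theorem not_both_of_value_ne₃ {a b : KZ.FormalRep} {s s' : KZ.IntegralRep 1}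
    (hv : s.value ≠ s'.value) (h : a - b + KZ.of s ∈ KZ.relations)
    (h' : a - b + KZ.of s' ∈ KZ.relations) : False := by
  have hd := KZ.relations.sub_mem h h'
  have : a - b + KZ.of s - (a - b + KZ.of s') = KZ.of s - KZ.of s' := by abel
  rw [this] at hd
  have := eval_eq_zero_of_mem_relations hd
  rw [map_sub, KZ.eval_of, KZ.eval_of, sub_eq_zero] at this
  exact hv this

/-- Two admissible first slots with different values cannot both give relations. [folklore] -/
theorem not_both_of_value_ne₁ {b c : KZ.FormalRep} {s s' : KZ.IntegralRep 1}
    (hv : s.value ≠ s'.value) (h : KZ.of s - b + c ∈ KZ.relations)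
    (h' : KZ.of s' - b + c ∈ KZ.relations) : False := by
  have hd := KZ.relations.sub_mem h h'
  have : KZ.of s - b + c - (KZ.of s' - b + c) = KZ.of s - KZ.of s' := by abel
  rw [this] at hd
  have := eval_eq_zero_of_mem_relations hd
  rw [map_sub, KZ.eval_of, KZ.eval_of, sub_eq_zero] at this
  exact hv this

/-- Two admissible second slots with different values cannot both give relations. [folklore] -/
theorem not_both_of_value_ne₂ {a c : KZ.FormalRep} {s s' : KZ.IntegralRep 1}
    (hv : s.value ≠ s'.value) (h : a - KZ.of s + c ∈ KZ.relations)
    (h' : a - KZ.of s' + c ∈ KZ.relations) : False := by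
  have hd := KZ.relations.sub_mem h' h
  have : a - KZ.of s' + c - (a - KZ.of s + c) = KZ.of s - KZ.of s' := by abel
  rw [this] at hd
  have := eval_eq_zero_of_mem_relations hd
  rw [map_sub, KZ.eval_of, KZ.eval_of, sub_eq_zero] at this
  exact hv this

/-- Any proof must use the DOMAIN hypothesis on `r₁`: the crux with `r₁.domain = (0,1)` deleted is
false (witnesses: the canonical `[(0,1), 1/√f]` of value `I₁ > 0` vs the empty-domain
representation of value `0`). [folklore] -/
theorem genusTwoCycleTransfer_false_without_domain₁ :
    ¬ (let f : ℝ → ℝ := fun x => x * (x - 1) * (x - 2) * (x - 3) * (x - 5); ∀ (r₁ r₂ r₃ : Literature.NumberTheory.Transcendental.KZ.IntegralRep 1), Set.EqOn r₁.integrand (fun p => 1 / Real.sqrt (f (p 0))) {p | 0 < p 0 ∧ p 0 < 1} → r₂.domain = {p | 2 < p 0 ∧ p 0 < 3} → Set.EqOn r₂.integrand (fun p => 1 / Real.sqrt (f (p 0))) {p | 2 < p 0 ∧ p 0 < 3} → r₃.domain = {p | 5 < p 0} → Set.EqOn r₃.integrand (fun p => 1 / Real.sqrt (f (p 0))) {p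 | 5 < p 0} → Literature.NumberTheory.Transcendental.KZ.of r₁ - Literature.NumberTheory.Transcendental.KZ.of r₂ + Literature.NumberTheory.Transcendental.KZ.of r₃ ∈ Literature.NumberTheory.Transcendental.KZ.relations) := by
  intro H
  obtain ⟨r₁, -, hi₁, -, hv₁⟩ := exists_rep01
  obtain ⟨r₂, hd₂, hi₂, -⟩ := exists_rep23
  obtain ⟨r₃, hd₃, hi₃, -⟩ := exists_rep5
  obtain ⟨e, -, hie, hve⟩ := exists_emptyRep
  have h := H r₁ r₂ r₃ (fun p _ => congrFun hi₁ p) hd₂ (fun p _ => congrFun hi₂ p) hd₃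
    (fun p _ => congrFun hi₃ p)
  have h' := H e r₂ r₃ (fun p _ => congrFun hie p) hd₂ (fun p _ => congrFun hi₂ p) hd₃
    (fun p _ => congrFun hi₃ p)
  exact not_both_of_value_ne₁ (by rw [hve]; exact hv₁.ne') h h'

/-- Any proof must use the INTEGRAND hypothesis on `r₁`: the crux with `EqOn r₁.integrand (1/√f)`
deleted is false (witnesses: the canonical one vs the zero integrand on `(0,1)`). [folklore] -/
theorem genusTwoCycleTransfer_false_without_integrand₁ :
    ¬ (let f : ℝ → ℝ := fun x => x * (x - 1) * (x - 2) * (x - 3) * (x - 5); ∀ (r₁ r₂ r₃ : Literature.NumberTheory.Transcendental.KZ.IntegralRep 1), r₁.domain = {p | 0 < p 0 ∧ p 0 < 1} → r₂.domain = {p | 2 < p 0 ∧ p 0 < 3} → Set.EqOn r₂.integrand (fun p => 1 / Real.sqrt (f (p 0))) {p | 2 < p 0 ∧ p 0 < 3} → r₃.domain = {p | 5 < p 0} → Set.EqOn r₃.integrand (fun p => 1 / Real.sqrt (f (p 0))) {p | 5 < p 0} → Literature.NumberTheory.Transcendental.KZ.of r₁ - Literature.NumberTheory.Transcendental.KZ.of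 r₂ + Literature.NumberTheory.Transcendental.KZ.of r₃ ∈ Literature.NumberTheory.Transcendental.KZ.relations) := by
  intro H
  obtain ⟨r₁, hd₁, -, -, hv₁⟩ := exists_rep01
  obtain ⟨r₂, hd₂, hi₂, -⟩ := exists_rep23
  obtain ⟨r₃, hd₃, hi₃, -⟩ := exists_rep5
  obtain ⟨z, hdz, -, hvz⟩ := exists_zeroRep isSemialgebraic_unitInterval_fin_one
  have h := H r₁ r₂ r₃ hd₁ hd₂ (fun p _ => congrFun hi₂ p) hd₃ (fun p _ => congrFun hi₃ p)
  have h' := H z r₂ r₃ hdz hd₂ (fun p _ => congrFun hi₂ p) hd₃ (fun p _ => congrFun hi₃ p)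
  exact not_both_of_value_ne₁ (by rw [hvz]; exact hv₁.ne') h h'

/-- Any proof must use the DOMAIN hypothesis on `r₂` (witnesses: canonical `[(2,3), 1/√f]`, value
`I₂ > 0`, vs the empty-domain representation). [folklore] -/
theorem genusTwoCycleTransfer_false_without_domain₂ :
    ¬ (let f : ℝ → ℝ := fun x => x * (x - 1) * (x - 2) * (x - 3) * (x - 5); ∀ (r₁ r₂ r₃ : Literature.NumberTheory.Transcendental.KZ.IntegralRep 1), r₁.domain = {p | 0 < p 0 ∧ p 0 < 1} → Set.EqOn r₁.integrand (fun p => 1 / Real.sqrt (f (p 0))) {p | 0 < p 0 ∧ p 0 < 1} → Set.EqOn r₂.integrand (fun p => 1 / Real.sqrt (f (p 0))) {p | 2 < p 0 ∧ p 0 < 3} → r₃.domain = {p | 5 < p 0} → Set.EqOn r₃.integrand (fun p => 1 / Real.sqrt (f (p 0))) {p | 5 < p 0} → Literature.NumberTheory.Transcendental.KZ.of r₁ - Literature.NumberTheory.Transcendental.KZ.of r₂ + Literature.NumberTheory.Transcendental.KZ.of r₃ ∈ Literature.NumberTheory.Transcendental.KZ.relations) := by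
  intro H
  obtain ⟨r₁, hd₁, hi₁, -⟩ := exists_rep01
  obtain ⟨r₂, -, hi₂, -, hv₂⟩ := exists_rep23
  obtain ⟨r₃, hd₃, hi₃, -⟩ := exists_rep5
  obtain ⟨e, -, hie, hve⟩ := exists_emptyRep
  have h := H r₁ r₂ r₃ hd₁ (fun p _ => congrFun hi₁ p) (fun p _ => congrFun hi₂ p) hd₃
    (fun p _ => congrFun hi₃ p)
  have h' := H r₁ e r₃ hd₁ (fun p _ => congrFun hi₁ p) (fun p _ => congrFun hie p) hd₃
    (fun p _ => congrFun hi₃ p)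
  exact not_both_of_value_ne₂ (by rw [hve]; exact hv₂.ne') h h'

/-- Any proof must use the INTEGRAND hypothesis on `r₂` (witnesses: canonical vs the zero integrand
on `(2,3)`). [folklore] -/
theorem genusTwoCycleTransfer_false_without_integrand₂ :
    ¬ (let f : ℝ → ℝ := fun x => x * (x - 1) * (x - 2) * (x - 3) * (x - 5); ∀ (r₁ r₂ r₃ : Literature.NumberTheory.Transcendental.KZ.IntegralRep 1), r₁.domain = {p | 0 < p 0 ∧ p 0 < 1} → Set.EqOn r₁.integrand (fun p => 1 / Real.sqrt (f (p 0))) {p | 0 < p 0 ∧ p 0 < 1} → r₂.domain = {p | 2 < p 0 ∧ p 0 < 3} → r₃.domain = {p | 5 < p 0} → Set.EqOn r₃.integrand (fun p => 1 / Real.sqrt (f (p 0))) {p | 5 < p 0} → Literature.NumberTheory.Transcendental.KZ.of r₁ - Literature.NumberTheory.Transcendental.KZ.of r₂ + Literature.NumberTheory.Transcendental.KZ.of r₃ ∈ Literature.NumberTheory.Transcendental.KZ.relations) := by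
  intro H
  obtain ⟨r₁, hd₁, hi₁, -⟩ := exists_rep01
  obtain ⟨r₂, hd₂, -, -, hv₂⟩ := exists_rep23
  obtain ⟨r₃, hd₃, hi₃, -⟩ := exists_rep5
  obtain ⟨z, hdz, -, hvz⟩ := exists_zeroRep isSemialgebraic_oval23
  have h := H r₁ r₂ r₃ hd₁ (fun p _ => congrFun hi₁ p) hd₂ hd₃ (fun p _ => congrFun hi₃ p)
  have h' := H r₁ z r₃ hd₁ (fun p _ => congrFun hi₁ p) hdz hd₃ (fun p _ => congrFun hi₃ p)
  exact not_both_of_value_ne₂ (by rw [hvz]; exact hv₂.ne') h h'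

/-- Any proof must use the DOMAIN hypothesis on `r₃` — in particular the UNBOUNDED oval cannot be
dropped (witnesses: canonical `[(5,∞), 1/√f]`, value `I₃ > 0`, vs the empty-domain
representation). [folklore] -/
theorem genusTwoCycleTransfer_false_without_domain₃ :
    ¬ (let f : ℝ → ℝ := fun x => x * (x - 1) * (x - 2) * (x - 3) * (x - 5); ∀ (r₁ r₂ r₃ : Literature.NumberTheory.Transcendental.KZ.IntegralRep 1), r₁.domain = {p | 0 < p 0 ∧ p 0 < 1} → Set.EqOn r₁.integrand (fun p => 1 / Real.sqrt (f (p 0))) {p | 0 < p 0 ∧ p 0 < 1} → r₂.domain = {p | 2 < p 0 ∧ p 0 < 3} → Set.EqOn r₂.integrand (fun p => 1 / Real.sqrt (f (p 0))) {p | 2 < p 0 ∧ p 0 < 3} → Set.EqOn r₃.integrand (fun p => 1 / Real.sqrt (f (p 0))) {p | 5 < p 0} → Literature.NumberTheory.Transcendental.KZ.of r₁ - Literature.NumberTheory.Transcendental.KZ.of r₂ + Literature.NumberTheory.Transcendental.KZ.of r₃ ∈ Literature.NumberTheory.Transcendental.KZ.relations) := by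
  intro H
  obtain ⟨r₁, hd₁, hi₁, -⟩ := exists_rep01
  obtain ⟨r₂, hd₂, hi₂, -⟩ := exists_rep23
  obtain ⟨r₃, -, hi₃, -, hv₃⟩ := exists_rep5
  obtain ⟨e, -, hie, hve⟩ := exists_emptyRep
  have h := H r₁ r₂ r₃ hd₁ (fun p _ => congrFun hi₁ p) hd₂ (fun p _ => congrFun hi₂ p)
    (fun p _ => congrFun hi₃ p)
  have h' := H r₁ r₂ e hd₁ (fun p _ => congrFun hi₁ p) hd₂ (fun p _ => congrFun hi₂ p)
    (fun p _ => congrFun hie p)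
  exact not_both_of_value_ne₃ (by rw [hve]; exact hv₃.ne') h h'

/-- Any proof must use the INTEGRAND hypothesis on `r₃` (witnesses: canonical vs the zero integrand
on `(5,∞)`). [folklore] -/
theorem genusTwoCycleTransfer_false_without_integrand₃ :
    ¬ (let f : ℝ → ℝ := fun x => x * (x - 1) * (x - 2) * (x - 3) * (x - 5); ∀ (r₁ r₂ r₃ : Literature.NumberTheory.Transcendental.KZ.IntegralRep 1), r₁.domain = {p | 0 < p 0 ∧ p 0 < 1} → Set.EqOn r₁.integrand (fun p => 1 / Real.sqrt (f (p 0))) {p | 0 < p 0 ∧ p 0 < 1} → r₂.domain = {p | 2 < p 0 ∧ p 0 < 3} → Set.EqOn r₂.integrand (fun p => 1 / Real.sqrt (f (p 0))) {p | 2 < p 0 ∧ p 0 < 3} → r₃.domain = {p | 5 < p 0} → Literature.NumberTheory.Transcendental.KZ.of r₁ - Literature.NumberTheory.Transcendental.KZ.of r₂ + Literature.NumberTheory.Transcendental.KZ.of r₃ ∈ Literature.NumberTheory.Transcendental.KZ.relations) := by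
  intro H
  obtain ⟨r₁, hd₁, hi₁, -⟩ := exists_rep01
  obtain ⟨r₂, hd₂, hi₂, -⟩ := exists_rep23
  obtain ⟨r₃, hd₃, -, -, hv₃⟩ := exists_rep5
  obtain ⟨z, hdz, -, hvz⟩ := exists_zeroRep isSemialgebraic_oval5
  have h := H r₁ r₂ r₃ hd₁ (fun p _ => congrFun hi₁ p) hd₂ (fun p _ => congrFun hi₂ p) hd₃
  have h' := H r₁ r₂ z hd₁ (fun p _ => congrFun hi₁ p) hd₂ (fun p _ => congrFun hi₂ p) hdz
  exact not_both_of_value_ne₃ (by rw [hvz]; exact hv₃.ne') h h'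

/-! ### §4 Sign pattern, and why there is no crux-local counterexample -/

/-- **The all-plus combination is not a relation**: its value is `I₁ + I₂ + I₃ > 0`. (The crux's
pattern `(+,−,+)` is the real part of the boundary phases `+1, −1, +1` of the upper-half-plane
branch of `1/√f`; numerically it is the only vanishing sign pattern.)
[cite: KontsevichZagier2001, §1.2] -/
theorem all_plus_not_mem_relations (r₁ r₂ r₃ : KZ.IntegralRep 1)
    (hd₁ : r₁.domain = {p | 0 < p 0 ∧ p 0 < 1})
    (hi₁ : EqOn r₁.integrand (fun p => 1 / Real.sqrt (p 0 * (p 0 - 1) * (p 0 - 2) * (p 0 - 3) * (p 0 - 5))) {p | 0 < p 0 ∧ p 0 < 1})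
    (hd₂ : r₂.domain = {p | 2 < p 0 ∧ p 0 < 3})
    (hi₂ : EqOn r₂.integrand (fun p => 1 / Real.sqrt (p 0 * (p 0 - 1) * (p 0 - 2) * (p 0 - 3) * (p 0 - 5))) {p | 2 < p 0 ∧ p 0 < 3})
    (hd₃ : r₃.domain = {p | 5 < p 0})
    (hi₃ : EqOn r₃.integrand (fun p => 1 / Real.sqrt (p 0 * (p 0 - 1) * (p 0 - 2) * (p 0 - 3) * (p 0 - 5))) {p | 5 < p 0}) :
    KZ.of r₁ + KZ.of r₂ + KZ.of r₃ ∉ KZ.relations := by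
  intro h
  have hv := eval_eq_zero_of_mem_relations h
  rw [map_add, map_add, KZ.eval_of, KZ.eval_of, KZ.eval_of,
    value_eq_setIntegral (S := Ioo 0 1) hd₁ hi₁, value_eq_setIntegral (S := Ioo 2 3) hd₂ hi₂,
    value_eq_setIntegral (S := Ioi 5) hd₃ hi₃] at hv
  linarith [setIntegral_invSqrt_pos (by simp) (fun x hx => quintic_pos_01 hx) integrableOn_Ioo01,
    setIntegral_invSqrt_pos (S := Ioo 2 3) (by simp; norm_num) (fun x hx => quintic_pos_23 hx)
      integrableOn_Ioo23,
    setIntegral_invSqrt_pos (by simp) (fun x hx => quintic_pos_5 hx) integrableOn_Ioi5]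

/-- **A refutation of the crux would refute the summit** (modulo the certified value identity).
If `I₁ − I₂ + I₃ = 0` — Cauchy's theorem for `dz/√f` on the upper half-plane (phases `+1, −1, +1`
of the boundary branch on the three ovals); numerically
`0.8026145263330726 − 1.059673979560619 + 0.25705945322754614 = 4·10⁻¹⁶` — then the summit
`KontsevichZagierPeriods` (equivalently its kernel form, `kzKernelConjecture_iff_isRational`)
implies `GenusTwoCycleTransfer`. Hence an additive invariant of `KZ.FormalRep` vanishing on the
four move sets but not on `[r₁] − [r₂] + [r₃]` would disprove the summit itself (route
HermiteRigidity, kill criteria). [cite: KontsevichZagier2001, §1.2 Conjecture 1] -/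
theorem genusTwoCycleTransfer_of_kontsevichZagierPeriods
    (hval : (∫ x in Ioo (0:ℝ) 1, 1 / Real.sqrt (x * (x - 1) * (x - 2) * (x - 3) * (x - 5))) - (∫ x in Ioo (2:ℝ) 3, 1 / Real.sqrt (x * (x - 1) * (x - 2) * (x - 3) * (x - 5)))
      + (∫ x in Ioi (5:ℝ), 1 / Real.sqrt (x * (x - 1) * (x - 2) * (x - 3) * (x - 5))) = 0)
    (hKZ : KontsevichZagierPeriods) : GenusTwoCycleTransfer := by
  have hK : KZKernelConjecture := kzKernelConjecture_iff_isRational.mpr hKZ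
  intro r₁ r₂ r₃ hd₁ hi₁ hd₂ hi₂ hd₃ hi₃
  apply hK
  simp only [map_add, map_sub, KZ.eval_of]
  rw [value_eq_setIntegral (S := Ioo 0 1) hd₁ hi₁, value_eq_setIntegral (S := Ioo 2 3) hd₂ hi₂,
    value_eq_setIntegral (S := Ioi 5) hd₃ hi₃]
  exact hval

end Summit.KontsevichZagierPeriods.HermiteRigidity.GenusTwoCycleTransferNegative

end
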